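import Literature.NumberTheory.Transcendental.KZProductIdeal
import Literature.NumberTheory.Transcendental.KZRulesAssociator

/-!
# `stub_intervalUnit` of skeleton d39c9ad6 (line `spectator-localisation`, crux
stmt-KontsevichZagierPeriods-2837) is a THEOREM — candidate proof for the lead prover

Refuter drefute seat `refuter-drefute-stmt-KontsevichZagierPeriods-2837-0`, 2026-08-16.
Statement (verbatim the registered stub signature):

  ∀ (a b : ℚ) (u : KZ.IntegralRep 1), a < b → u.domain = {t | ↑a ≤ t 0 ∧ t 0 ≤ ↑b} →
    (u.integrand = fun _ => ((b - a : ℚ) : ℝ)⁻¹) → ∀ c, KZ.of u * c - c ∈ KZ.relations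

Proof: `[u] − [pt,1] ∈ relations` is ONE Newton–Leibniz move over the point (base `KZ.IntegralRep.unit`,
bounds the constants `a ≤ b`, primitive `F(t) = (t − a)(b − a)⁻¹`); then
`[u] * c − c = ([u] − [pt,1]) * c + ([pt,1] * c − c)` with the right-ideal property
`KZ.mul_mem_relations_right_holds` and the tree's unit lemma `KZ.of_unit_mul_sub_mem_relations`.
Also: the hypotheses are met by `iccRep a b` (non-vacuity), whose value is `1`.
-/

noncomputable section

namespace DrefuteSpectatorLocalisation

open Literature.NumberTheory.Transcendental MeasureTheory Set MvPolynomial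

/-- `[[a,b], (b-a)⁻¹] − [pt, 1] ∈ relations`: a single Newton–Leibniz move over the point, primitive
`F(t) = (t − a)(b − a)⁻¹`. [folklore] -/
theorem of_interval_sub_of_unit_mem_relations (a b : ℚ) (u : KZ.IntegralRep 1) (hab : a < b)
    (hdom : u.domain = {t : Fin 1 → ℝ | (a : ℝ) ≤ t 0 ∧ t 0 ≤ (b : ℝ)})
    (hint : u.integrand = fun _ => ((b - a : ℚ) : ℝ)⁻¹) :
    KZ.of u - KZ.of KZ.IntegralRep.unit ∈ KZ.relations := by
  apply KZ.newtonLeibnizRel_subset_relations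
  have hba : ((b - a : ℚ) : ℝ) ≠ 0 := by
    have : (a : ℝ) < b := by exact_mod_cast hab
    push_cast; linarith
  set F : (Fin (0 + 1) → ℝ) → ℝ := fun z => (z (Fin.last 0) - (a : ℝ)) * ((b - a : ℚ) : ℝ)⁻¹ with hF
  refine ⟨0, u, KZ.IntegralRep.unit, fun _ => (a : ℝ), fun _ => (b : ℝ), F, ?_, ?_, ?_, ?_, ?_, ?_, ?_, ?_, rfl⟩
  · refine (isSemialgebraicFunOn_aeval u.isSemialgebraic_domain
      ((X (Fin.last 0) - C a) * C ((b - a)⁻¹))).congr fun z _ => ?_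
    simp only [hF, map_mul, map_sub, aeval_X, aeval_C, eq_ratCast]
    push_cast
    ring
  · refine (isSemialgebraicFunOn_aeval KZ.IntegralRep.unit.isSemialgebraic_domain (C a)).congr
      fun z _ => ?_
    simp
  · refine (isSemialgebraicFunOn_aeval KZ.IntegralRep.unit.isSemialgebraic_domain (C b)).congr
      fun z _ => ?_
    simp
  · intro x _
    show (a : ℝ) ≤ (b : ℝ)
    exact_mod_cast hab.le
  · ext z
    simp only [hdom, mem_setOf_eq, KZ.IntegralRep.unit_domain, mem_univ, true_and]
    rfl
  · intro x _
    simp only [hF, Fin.snoc_last]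
    fun_prop
  · intro x _ t _
    simp only [hF, Fin.snoc_last, hint]
    simpa using ((hasDerivAt_id t).sub_const (a : ℝ)).mul_const (((b - a : ℚ) : ℝ)⁻¹)
  · intro x _
    simp only [hF, Fin.snoc_last, KZ.IntegralRep.unit_integrand]
    rw [sub_self, zero_mul, sub_zero]
    push_cast at hba ⊢
    field_simp

/-- **`stub_intervalUnit` holds** (verbatim the registered signature). [folklore] -/
theorem stub_intervalUnit_holds :
    ∀ (a b : ℚ) (u : Literature.NumberTheory.Transcendental.KZ.IntegralRep 1), a < b → u.domain = {t : Fin 1 → ℝ | (a : ℝ) ≤ t 0 ∧ t 0 ≤ (b : ℝ)} → (u.integrand = fun _ => ((b - a : ℚ) : ℝ)⁻¹) → ∀ c : Literature.NumberTheory.Transcendental.KZ.FormalRep, Literature.NumberTheory.Transcendental.KZ.of u * c - c ∈ Literature.NumberTheory.Transcendental.KZ.relations := by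
  intro a b u hab hdom hint c
  have h1 : (KZ.of u - KZ.of KZ.IntegralRep.unit) * c ∈ KZ.relations :=
    KZ.mul_mem_relations_right_holds _ _ (of_interval_sub_of_unit_mem_relations a b u hab hdom hint)
  have h2 := KZ.of_unit_mul_sub_mem_relations c
  have : KZ.of u * c - c =
      (KZ.of u - KZ.of KZ.IntegralRep.unit) * c + (KZ.of KZ.IntegralRep.unit * c - c) := by
    rw [sub_mul]; abel
  rw [this]
  exact KZ.relations.add_mem h1 h2

/-! ### Non-vacuity: the interval representation `[[a,b], (b−a)⁻¹]` -/

theorem isSemialgebraic_iccSet (a b : ℚ) :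
    Literature.ModelTheory.ExponentialFields.IsSemialgebraic ℚ
      {t : Fin 1 → ℝ | (a : ℝ) ≤ t 0 ∧ t 0 ≤ (b : ℝ)} := by
  have h1 := Literature.ModelTheory.ExponentialFields.isSemialgebraic_setOf_eval_le (k := ℚ) (R := ℝ)
    (C a) (X (0 : Fin 1))
  have h2 := Literature.ModelTheory.ExponentialFields.isSemialgebraic_setOf_eval_le (k := ℚ) (R := ℝ)
    (X (0 : Fin 1)) (C b)
  simp only [aeval_X, aeval_C, eq_ratCast] at h1 h2
  simpa [setOf_and] using h1.inter h2

theorem iccSet_eq_pi (a b : ℚ) :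
    {t : Fin 1 → ℝ | (a : ℝ) ≤ t 0 ∧ t 0 ≤ (b : ℝ)} = Set.pi univ (fun _ => Icc (a : ℝ) b) := by
  ext t
  simp [Pi.le_def, Fin.forall_fin_one]

theorem volume_iccSet (a b : ℚ) :
    volume {t : Fin 1 → ℝ | (a : ℝ) ≤ t 0 ∧ t 0 ≤ (b : ℝ)} = ENNReal.ofReal ((b : ℝ) - a) := by
  rw [iccSet_eq_pi, volume_pi_pi]
  simp [Real.volume_Icc]

/-- `[[a,b], (b−a)⁻¹] : KZ.IntegralRep 1`. [folklore] -/
def iccRep (a b : ℚ) : KZ.IntegralRep 1 where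
  domain := {t : Fin 1 → ℝ | (a : ℝ) ≤ t 0 ∧ t 0 ≤ (b : ℝ)}
  integrand := fun _ => ((b - a : ℚ) : ℝ)⁻¹
  isSemialgebraic_domain := isSemialgebraic_iccSet a b
  isSemialgebraicFunOn_integrand := by
    refine (isSemialgebraicFunOn_aeval (isSemialgebraic_iccSet a b) (C ((b - a)⁻¹))).congr
      fun z _ => ?_
    simp only [aeval_C, eq_ratCast]
    push_cast
    rfl
  integrableOn := by
    refine integrableOn_const ?_
    rw [volume_iccSet]
    exact ENNReal.ofReal_ne_top

theorem iccRep_value (a b : ℚ) (hab : a < b) : (iccRep a b).value = 1 := by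
  have hba : (0 : ℝ) < (b : ℝ) - a := by
    have : (a : ℝ) < b := by exact_mod_cast hab
    linarith
  rw [KZ.IntegralRep.value]
  simp only [iccRep, setIntegral_const]
  rw [Measure.real, volume_iccSet, ENNReal.toReal_ofReal hba.le]
  push_cast
  rw [smul_eq_mul, mul_inv_cancel₀ hba.ne']

/-- Non-vacuity of `stub_intervalUnit`: `[[a,b],(b−a)⁻¹] * c − c ∈ relations`. -/
theorem of_iccRep_mul_sub_mem_relations (a b : ℚ) (hab : a < b) (c : KZ.FormalRep) :
    KZ.of (iccRep a b) * c - c ∈ KZ.relations :=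
  stub_intervalUnit_holds a b (iccRep a b) hab rfl rfl c

end DrefuteSpectatorLocalisation
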